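import Summits.ValiantsHypothesis.ValiantsHypothesis.Theorems.KPlusLogSqLawTridiagonalRealStaticUnitSplitting
import Summits.ValiantsHypothesis.ValiantsHypothesis.Theorems.KPlusLogSqLawTridiagonalRealStaticUnitRecessiveCountAll
import Summits.ValiantsHypothesis.ValiantsHypothesis.Theorems.KPlusLogSqLawTridiagonalRealStaticUnitMirrorCount

/-!
# Route «KPlusLogSqLaw», crux `WeakLifting` (stmt-ValiantsHypothesis-19561) — REAL side of the tridiagonal sector:
# the UNIT-COEFFICIENT sub-sector — THE RECESSIVE COUNT LAW WITH THE SLOPE SIGNS AS THE ONLY HYPOTHESIS (`3 ≤ m ≤ 8`)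

HONEST FRAMING.  Helper theorems (`--supports stmt-ValiantsHypothesis-19561 --as helper`), seat val-sym-lift-p1 (g19), cell `pub-symmetroid`,
2026-08-28; sharpens g18's `…UnitSturmWindowCount` (p637784), `…UnitRecessiveCount` (p638066), `…UnitRecessiveCountAll` (p638539) and
`…UnitMirrorCount` (p639421) by the crossing-direction law AT EVERY ZERO of `…UnitSplitting` (`negType_below_one_sharp`,
`rootMultiplicity_eq_one_sharp`): the non-degeneracy hypothesis «`D_1, …, D_{m−1} ≠ 0` at every zero» is REMOVED throughout.  Continuants
`D_k = pathDet (fun _ => 1) d (fun _ => 1) f k`, Sturm count `V(x) = #{k < m : D_k(x)D_{k+1}(x) < 0}`.  Proved here (all exponents, `3 ≤ m ≤ 8`):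
* `card_roots_window_add_sturm_eq_sharp`: all slopes positive, `0 < a < b < 1`, no `D_k` vanishing at `a`, `b` ⇒ `#zeros in (a,b) + V(a) = V(b)`;
* `card_roots_below_eq_sturm_sharp`: zeros in `(0,b)` = `V(b)`;
* **`card_roots_unit_interval_eq_div_three_sharp`** / **`card_posRoots_unit_interval_eq_div_three_sharp`**: EVERY unit-coefficient static symmetric
  tridiagonal design of size `3 ≤ m ≤ 8` with all edge slopes positive has EXACTLY `⌊m/3⌋` zeros of `D_m` in `(0,1)` (with multiplicity = distinct:
  all simple) — hypotheses: the slope signs, nothing else;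
* **`card_posRoots_above_one_eq_div_three_sharp`** (mirror): all slopes negative ⇒ exactly `⌊m/3⌋` distinct zeros in `(1,∞)`.
So: every one-signed unit design of size `3 ≤ m ≤ 8` has exactly `⌊m/3⌋` zeros on its recessive side, all simple, for all exponents.  (From `m = 9`
on the count can exceed `⌊m/3⌋`: memo CROSSING-DIRECTION-liftp1g18.md §3, integer witness with five zeros in `(0,1)`.)
Nothing here is an upper law for the register (α NO MOVER); nothing bears on `WeakLifting` / `TropicalB` (stmt-19771) in their windows, Conjecture B,
the Door-A registers, `MatrixDescartes` (stmt-18050) or VP ≠ VNP.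
[this seat; folklore: Sturm sequences, definite-type eigenvalue crossings]
-/

-- `Summit.ValiantsHypothesis.ValiantsHypothesis.…` repeats a component by the D-0017 layout (single-conjunct summit); the name is mandated.
set_option linter.dupNamespace false
set_option autoImplicit false

namespace Summit.ValiantsHypothesis.ValiantsHypothesis.Theorems.KPlusLogSqLaw
namespace StaticTridiagonalRealUnit

open Real Finset Polynomial Matrix Filter Topology
open Summit.ValiantsHypothesis.ValiantsHypothesis.Theorems.KPlusLogSqLaw.StaticTridiagonalRealPotential (pathDet)

variable (d : ℕ → ℕ) (f : ℕ → ℕ)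

/-! ### 1. The exact window count without non-degeneracy -/

/-- **EXACT WINDOW COUNT (`3 ≤ m ≤ 8`, all exponents, every zero)**: all slopes positive, `0 < a < b < 1`, no `D_k` (`k ≤ m`) vanishing at `a` or
`b`.  Then `#{zeros of D_m in (a,b), with multiplicity} + V(a) = V(b)` — g18's `card_roots_window_add_sturm_eq_of_le_eight` without the
non-degeneracy hypothesis on the zeros inside the window. [this file] -/
theorem card_roots_window_add_sturm_eq_sharp (m : ℕ) (hm : 3 ≤ m) (hm8 : m ≤ 8) {a b : ℝ} (ha0 : 0 < a) (hab : a < b) (hb1 : b < 1)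
    (hslope : ∀ k, k + 1 < m → d k + d (k + 1) < 2 * f k)
    (ha : ∀ k, k ≤ m → (pathDet (fun _ => (1 : ℝ)) d (fun _ => (1 : ℝ)) f k).eval a ≠ 0)
    (hb : ∀ k, k ≤ m → (pathDet (fun _ => (1 : ℝ)) d (fun _ => (1 : ℝ)) f k).eval b ≠ 0) :
    Multiset.card ((pathDet (fun _ => (1 : ℝ)) d (fun _ => (1 : ℝ)) f m).roots.filter (fun t => a < t ∧ t < b)) +
        (Finset.univ.filter fun k : Fin m =>
          (pathDet (fun _ => (1 : ℝ)) d (fun _ => (1 : ℝ)) f k).eval a * (pathDet (fun _ => (1 : ℝ)) d (fun _ => (1 : ℝ)) f (k + 1)).eval a < 0).card =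
      (Finset.univ.filter fun k : Fin m =>
          (pathDet (fun _ => (1 : ℝ)) d (fun _ => (1 : ℝ)) f k).eval b * (pathDet (fun _ => (1 : ℝ)) d (fun _ => (1 : ℝ)) f (k + 1)).eval b < 0).card := by
  classical
  have hS := unitLetter_isSymm m
  have hdet : ∀ x : ℝ, (∑ κ, x ^ unitExponent d f m κ • unitLetter m κ).det = (pathDet (fun _ => (1 : ℝ)) d (fun _ => (1 : ℝ)) f m).eval x := by
    intro x
    rw [unitPencil_eq_ctPath, Summit.ValiantsHypothesis.ValiantsHypothesis.Theorems.KPlusLogSqLaw.SturmJacobi.det_evalPath]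
  have hwin := Summit.ValiantsHypothesis.ValiantsHypothesis.Theorems.LacunarySymmetroidMatrixDescartes.Inertia.card_roots_Ioo_add_negIndex_eq_of_negType
    (unitExponent d f m) (unitLetter m) hS hab (by rw [hdet]; exact ha m le_rfl) (by rw [hdet]; exact hb m le_rfl)
    (fun t hat htb hdt u hu hu0 => negType_below_one_sharp d f m hm hm8 t (ha0.trans hat) (htb.trans hb1) hslope
      (by rw [← hdet]; exact hdt) u hu hu0)
  obtain ⟨h1, -⟩ := hwin
  rw [det_unitPencil] at h1
  have hνa := Summit.ValiantsHypothesis.ValiantsHypothesis.Theorems.KPlusLogSqLaw.SturmJacobi.negIndex_eval_eq_sturmCount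
    (fun _ => (1 : ℝ)) d (fun _ => (1 : ℝ)) f m (x := a) ha
  have hνb := Summit.ValiantsHypothesis.ValiantsHypothesis.Theorems.KPlusLogSqLaw.SturmJacobi.negIndex_eval_eq_sturmCount
    (fun _ => (1 : ℝ)) d (fun _ => (1 : ℝ)) f m (x := b) hb
  have ea : Fintype.card {j // (Summit.ValiantsHypothesis.ValiantsHypothesis.Theorems.LacunarySymmetroidMatrixDescartes.Inertia.isHermitian_pencil
      (unitExponent d f m) (unitLetter m) hS a).eigenvalues j < 0} =
      (Finset.univ.filter fun k : Fin m =>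
        (pathDet (fun _ => (1 : ℝ)) d (fun _ => (1 : ℝ)) f k).eval a * (pathDet (fun _ => (1 : ℝ)) d (fun _ => (1 : ℝ)) f (k + 1)).eval a < 0).card := by
    rw [negIndex_congr (unitPencil_eq_ctPath d f m a) _
      (Summit.ValiantsHypothesis.ValiantsHypothesis.Theorems.KPlusLogSqLaw.SturmJacobi.ctPathSymm_isHermitian _ _ m)]
    exact hνa
  have eb : Fintype.card {j // (Summit.ValiantsHypothesis.ValiantsHypothesis.Theorems.LacunarySymmetroidMatrixDescartes.Inertia.isHermitian_pencil
      (unitExponent d f m) (unitLetter m) hS b).eigenvalues j < 0} =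
      (Finset.univ.filter fun k : Fin m =>
        (pathDet (fun _ => (1 : ℝ)) d (fun _ => (1 : ℝ)) f k).eval b * (pathDet (fun _ => (1 : ℝ)) d (fun _ => (1 : ℝ)) f (k + 1)).eval b < 0).card := by
    rw [negIndex_congr (unitPencil_eq_ctPath d f m b) _
      (Summit.ValiantsHypothesis.ValiantsHypothesis.Theorems.KPlusLogSqLaw.SturmJacobi.ctPathSymm_isHermitian _ _ m)]
    exact hνb
  rw [ea, eb] at h1
  exact h1

/-! ### 2. Below a scale -/

/-- **ZEROS BELOW A SCALE = STURM COUNT (`3 ≤ m ≤ 8`, every zero)**: all slopes positive, `0 < b < 1` with no `D_k` (`k ≤ m`) vanishing at `b` ⇒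
the zeros of `D_m` in `(0,b)` counted with multiplicity number exactly `V(b)`. [this file] -/
theorem card_roots_below_eq_sturm_sharp (m : ℕ) (hm : 3 ≤ m) (hm8 : m ≤ 8) {b : ℝ} (hb0 : 0 < b) (hb1 : b < 1)
    (hslope : ∀ k, k + 1 < m → d k + d (k + 1) < 2 * f k)
    (hb : ∀ k, k ≤ m → (pathDet (fun _ => (1 : ℝ)) d (fun _ => (1 : ℝ)) f k).eval b ≠ 0) :
    Multiset.card ((pathDet (fun _ => (1 : ℝ)) d (fun _ => (1 : ℝ)) f m).roots.filter (fun t => 0 < t ∧ t < b)) =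
      (Finset.univ.filter fun k : Fin m =>
          (pathDet (fun _ => (1 : ℝ)) d (fun _ => (1 : ℝ)) f k).eval b * (pathDet (fun _ => (1 : ℝ)) d (fun _ => (1 : ℝ)) f (k + 1)).eval b < 0).card := by
  set a := b / 4 with ha_def
  have ha0 : 0 < a := by rw [ha_def]; positivity
  have ha4 : a ≤ 1 / 4 := by rw [ha_def]; linarith
  have hab : a < b := by rw [ha_def]; linarith
  have hposA : ∀ x, 0 < x → x ≤ a → ∀ k, k ≤ m → 0 < (pathDet (fun _ => (1 : ℝ)) d (fun _ => (1 : ℝ)) f k).eval x := by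
    intro x hx hxa k hk
    rcases Nat.eq_zero_or_pos k with rfl | hk0
    · rw [(eval_unit_zero_one d f x).1]; exact one_pos
    · obtain ⟨k', rfl⟩ : ∃ k', k = k' + 1 := ⟨k - 1, by omega⟩
      exact (continuant_pos_of_le_quarter d f m x hx (hxa.trans ha4) hslope k' (by omega)).1
  have hwin := card_roots_window_add_sturm_eq_sharp d f m hm hm8 ha0 hab hb1 hslope (fun k hk => (hposA a ha0 le_rfl k hk).ne') hb
  have hVa : (Finset.univ.filter fun k : Fin m =>
      (pathDet (fun _ => (1 : ℝ)) d (fun _ => (1 : ℝ)) f k).eval a * (pathDet (fun _ => (1 : ℝ)) d (fun _ => (1 : ℝ)) f (k + 1)).eval a < 0).card = 0 := by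
    rw [Finset.card_eq_zero, Finset.filter_eq_empty_iff]
    intro k _
    exact not_lt.2 (mul_pos (hposA a ha0 le_rfl k (by omega)) (hposA a ha0 le_rfl (k + 1) (by omega))).le
  have hfilt : (pathDet (fun _ => (1 : ℝ)) d (fun _ => (1 : ℝ)) f m).roots.filter (fun t => 0 < t ∧ t < b) =
      (pathDet (fun _ => (1 : ℝ)) d (fun _ => (1 : ℝ)) f m).roots.filter (fun t => a < t ∧ t < b) := by
    refine Multiset.filter_congr fun t ht => ⟨fun h => ⟨?_, h.2⟩, fun h => ⟨ha0.trans h.1, h.2⟩⟩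
    by_contra hle
    have hroot : (pathDet (fun _ => (1 : ℝ)) d (fun _ => (1 : ℝ)) f m).eval t = 0 := (mem_roots'.1 ht).2
    exact (hposA t h.1 (not_lt.1 hle) m le_rfl).ne' hroot
  rw [hfilt, ← hwin, hVa, add_zero]

/-! ### 3. The recessive count law, slope signs only -/

/-- **THE RECESSIVE COUNT LAW (`3 ≤ m ≤ 8`, all exponents; slope signs only)**: every unit-coefficient static symmetric tridiagonal design of size
`3 ≤ m ≤ 8` with all edge slopes positive (`d_k + d_{k+1} < 2f_k`) has EXACTLY `⌊m/3⌋` zeros of `D_m` in `(0,1)`, counted with multiplicity.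
[this file] -/
theorem card_roots_unit_interval_eq_div_three_sharp (m : ℕ) (hm : 3 ≤ m) (hm8 : m ≤ 8)
    (hslope : ∀ k, k + 1 < m → d k + d (k + 1) < 2 * f k) :
    Multiset.card ((pathDet (fun _ => (1 : ℝ)) d (fun _ => (1 : ℝ)) f m).roots.filter (fun t => 0 < t ∧ t < 1)) = m / 3 := by
  have hev : ∀ᶠ x in 𝓝[<] (1 : ℝ), ∀ k ∈ range (m + 1),
      0 < (if k % 6 < 3 then (1 : ℝ) else -1) * (pathDet (fun _ => (1 : ℝ)) d (fun _ => (1 : ℝ)) f k).eval x :=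
    (Finset.eventually_all (range (m + 1))).2 fun k hk =>
      eventually_signTable_near_one d f m hslope k (by rw [mem_range] at hk; omega)
  obtain ⟨δ, hδ, hnear⟩ := exists_delta_of_eventually hev
  set b : ℝ := 1 - min δ 1 / 2 with hb_def
  have hmin : 0 < min δ 1 := lt_min hδ one_pos
  have hb0 : 0 < b := by rw [hb_def]; have := min_le_right δ 1; linarith
  have hb1 : b < 1 := by rw [hb_def]; linarith
  have hbδ : 1 - δ < b := by rw [hb_def]; have := min_le_left δ 1; linarith
  have hsignAt : ∀ x, b ≤ x → x < 1 → ∀ k, k ≤ m →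
      0 < (if k % 6 < 3 then (1 : ℝ) else -1) * (pathDet (fun _ => (1 : ℝ)) d (fun _ => (1 : ℝ)) f k).eval x :=
    fun x hx1 hx2 k hk => hnear x (by linarith) hx2 k (by rw [mem_range]; omega)
  obtain ⟨hV, hbne⟩ := sturmCount_of_signTable d f m b (hsignAt b le_rfl hb1)
  have hbelow := card_roots_below_eq_sturm_sharp d f m hm hm8 hb0 hb1 hslope hbne
  rw [hV] at hbelow
  rw [← hbelow]
  congr 1
  refine Multiset.filter_congr fun t ht => ⟨fun h => ⟨h.1, ?_⟩, fun h => ⟨h.1, h.2.trans hb1⟩⟩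
  by_contra hge
  have hroot : (pathDet (fun _ => (1 : ℝ)) d (fun _ => (1 : ℝ)) f m).eval t = 0 := (mem_roots'.1 ht).2
  have := hsignAt t (not_lt.1 hge) h.2 m le_rfl
  rw [hroot, mul_zero] at this
  exact lt_irrefl _ this

/-- **THE RECESSIVE COUNT LAW in the census currency (`3 ≤ m ≤ 8`; slope signs only)**: all edge slopes positive ⇒ the DISTINCT zeros of `D_m` in
`(0,1)` number exactly `⌊m/3⌋` (and all of them are simple). [this file] -/
theorem card_posRoots_unit_interval_eq_div_three_sharp (m : ℕ) (hm : 3 ≤ m) (hm8 : m ≤ 8)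
    (hslope : ∀ k, k + 1 < m → d k + d (k + 1) < 2 * f k) :
    (((pathDet (fun _ => (1 : ℝ)) d (fun _ => (1 : ℝ)) f m).roots.toFinset).filter (fun t => 0 < t ∧ t < 1)).card = m / 3 := by
  classical
  rw [← card_roots_unit_interval_eq_div_three_sharp d f m hm hm8 hslope, ← Multiset.toFinset_filter]
  refine Multiset.toFinset_card_of_nodup ?_
  rw [Multiset.nodup_iff_count_le_one]
  intro t
  rw [Multiset.count_filter]
  split_ifs with h
  · rw [count_roots]
    by_cases hroot : (pathDet (fun _ => (1 : ℝ)) d (fun _ => (1 : ℝ)) f m).eval t = 0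
    · exact (rootMultiplicity_eq_one_sharp d f m hm hm8 t h.1 h.2 hslope hroot).le
    · rw [rootMultiplicity_eq_zero hroot]; exact Nat.zero_le _
  · exact Nat.zero_le _

/-! ### 4. The mirror law above the resonance -/

/-- **THE DOMINANT-MIRROR COUNT LAW (`3 ≤ m ≤ 8`, all exponents; slope signs only)**: all edge slopes NEGATIVE (`2f_k < d_k + d_{k+1}`) ⇒ the
DISTINCT zeros of `D_m` in `(1, ∞)` number exactly `⌊m/3⌋` — g18's `card_posRoots_above_one_eq_div_three` without the non-degeneracy hypothesis
(reflection `d ↦ c − d`, `f ↦ c − f`, `t ↦ 1/t`). [this file] -/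
theorem card_posRoots_above_one_eq_div_three_sharp (m : ℕ) (hm : 3 ≤ m) (hm8 : m ≤ 8)
    (hslope : ∀ k, k + 1 < m → 2 * f k < d k + d (k + 1)) :
    (((pathDet (fun _ => (1 : ℝ)) d (fun _ => (1 : ℝ)) f m).roots.toFinset).filter (fun t => 1 < t)).card = m / 3 := by
  classical
  set c : ℕ := ∑ i ∈ range m, d i + ∑ k ∈ range m, f k with hc
  have hdc : ∀ i, i < m → d i ≤ c := fun i hi =>
    (Finset.single_le_sum (fun j _ => Nat.zero_le (d j)) (mem_range.2 hi)).trans (Nat.le_add_right _ _)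
  have hfc : ∀ k, k + 1 < m → f k ≤ c := fun k hk =>
    (Finset.single_le_sum (fun j _ => Nat.zero_le (f j)) (mem_range.2 (by omega : k < m))).trans (Nat.le_add_left _ _)
  set d' : ℕ → ℕ := fun i => c - d i with hd'
  set f' : ℕ → ℕ := fun k => c - f k with hf'
  have hslope' : ∀ k, k + 1 < m → d' k + d' (k + 1) < 2 * f' k := by
    intro k hk
    have h1 := hdc k (by omega); have h2 := hdc (k + 1) hk; have h3 := hfc k hk; have h4 := hslope k hk
    simp only [hd', hf']; omega
  have hrefl : ∀ y : ℝ, y ≠ 0 → ∀ k, k ≤ m → y ^ (k * c) * (pathDet (fun _ => (1 : ℝ)) d (fun _ => (1 : ℝ)) f k).eval (1 / y) =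
      (pathDet (fun _ => (1 : ℝ)) d' (fun _ => (1 : ℝ)) f' k).eval y := fun y hy => eval_reflect d f c m hdc hfc y hy
  have hcount := card_posRoots_unit_interval_eq_div_three_sharp d' f' m hm hm8 hslope'
  have hpos' : 0 < (pathDet (fun _ => (1 : ℝ)) d' (fun _ => (1 : ℝ)) f' m).eval (1 / 4) := by
    obtain ⟨n, rfl⟩ : ∃ n, m = n + 1 := ⟨m - 1, by omega⟩
    exact (continuant_pos_of_le_quarter d' f' (n + 1) (1 / 4) (by norm_num) le_rfl hslope' n (by omega)).1
  have hP' : pathDet (fun _ => (1 : ℝ)) d' (fun _ => (1 : ℝ)) f' m ≠ 0 := by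
    intro h0; rw [h0, eval_zero] at hpos'; exact lt_irrefl _ hpos'
  have hP : pathDet (fun _ => (1 : ℝ)) d (fun _ => (1 : ℝ)) f m ≠ 0 := by
    intro h0
    have := hrefl (1 / 4) (by norm_num) m le_rfl
    rw [h0, eval_zero, mul_zero] at this
    rw [← this] at hpos'
    exact lt_irrefl _ hpos'
  rw [← hcount]
  refine Finset.card_nbij (fun t => 1 / t) (fun t ht => ?_) (fun t₁ ht₁ t₂ ht₂ h => ?_) (fun s hs => ?_)
  · rw [Finset.mem_coe, Finset.mem_filter, Multiset.mem_toFinset, mem_roots hP] at ht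
    obtain ⟨hroot, ht1⟩ := ht
    have ht0 : 0 < t := by linarith
    rw [Finset.mem_coe, Finset.mem_filter, Multiset.mem_toFinset, mem_roots hP', IsRoot.def]
    refine ⟨?_, by positivity, by rw [div_lt_one ht0]; exact ht1⟩
    rw [← hrefl (1 / t) (by positivity) m le_rfl, one_div_one_div, IsRoot.def.1 hroot, mul_zero]
  · have h' : (1 : ℝ) / t₁ = 1 / t₂ := h
    rwa [one_div, one_div, _root_.inv_inj] at h'
  · rw [Finset.mem_coe, Finset.mem_filter, Multiset.mem_toFinset, mem_roots hP'] at hs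
    obtain ⟨hroot, hs0, hs1⟩ := hs
    refine ⟨1 / s, ?_, by show 1 / (1 / s) = s; rw [one_div_one_div]⟩
    rw [Finset.mem_coe, Finset.mem_filter, Multiset.mem_toFinset, mem_roots hP, IsRoot.def]
    refine ⟨?_, by rw [lt_div_iff₀ hs0]; linarith⟩
    have := hrefl s hs0.ne' m le_rfl
    rw [IsRoot.def.1 hroot] at this
    rcases mul_eq_zero.1 this with h | h
    · exact absurd h (pow_ne_zero _ hs0.ne')
    · exact h

end StaticTridiagonalRealUnit
end Summit.ValiantsHypothesis.ValiantsHypothesis.Theorems.KPlusLogSqLaw
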